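import Summits.CriticalPhenomena.PercolationContinuityZ3.Theorems.Transplant.FKConnectivityAllQAntipodalCellAlgebra
import HarnessLib

/-!
# Connectivity correlation inequalities for `φ_{w,q}`, every `q > 0` — file 45d: the four-edge THRESHOLD events in EVERY cell

Support file (`--supports stmt-CriticalPhenomena-4575`), FK sub-lane `prim-bschramm-fk-2` (gen 20); builds on p205010 (kernel theorem,
internal audit signed; external expert review pending).  No definitions, no named facts, no sorries; standard axioms.

File 34's level-4 identity with a contracted set (`FK.apPsiC_thr3of4_eq`: `thr₃ = ½·(four U¹¹) + AND₄` on the sixteen patterns of the live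
quadruple inside the arguments `γ ∪ C`), `FK.apPsiC_thr2of4_eq_thr3of4`, and — with U¹¹ in every cell (file 44b) and AND in every cell (file 45a) —
**`FK.apPsiC_thr3of4_sub_nonpos_of_isTTSP`**, **`FK.apPsiC_thr2of4_sub_nonpos_of_isTTSP`**: for live `M`, contracted `C` (disjoint, inside a
2-connected series–parallel host), distinct `x, y, z, w ∈ M`, `0 < q ≤ 1` and `g` increasing on the subsets of `M` reading none of `x, y, z, w` nor
`C`: the coefficient `[z^{2·1_C+1_M}] Z_H² Cov_{φ_{z,q}}(1{≥ j of the 4 edges}, g)` is `≤ 0` (`j = 2, 3`; `j = 1, 4` are OR / AND, file 45a).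
[cite: Grimmett2006, §1.4 eq. (1.20) (p. 15); §3.8 Thm. (3.90) (pp. 61–62); §3.9 (pp. 63–64)] [cite: Wagner2006, Thm. 5.8(d), §5.3]
-/

noncomputable section

namespace Summit.CriticalPhenomena.PercolationContinuityZ3.Theorems

namespace FK

open Literature.Probability.LatticeModels Literature.Probability.Percolation
open scoped Classical

universe u

variable {V : Type u}

/-- **The level-4 identity with a contracted set** (`x, y, z, w ∈ M ∖ C`). [folklore] -/
theorem apPsiC_thr3of4_eq (q : ℝ) {M C : Finset (Sym2 V)} {x y z w : Sym2 V} (hx : x ∈ M) (hy : y ∈ M) (hz : z ∈ M) (hw : w ∈ M)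
    (hxC : x ∉ C) (hyC : y ∉ C) (hzC : z ∉ C) (hwC : w ∉ C) (g : Finset (Sym2 V) → ℝ) :
    apPsiC q M C (fun A => if (x ∈ A ∧ y ∈ A ∧ z ∈ A) ∨ (x ∈ A ∧ y ∈ A ∧ w ∈ A) ∨ (x ∈ A ∧ z ∈ A ∧ w ∈ A) ∨
        (y ∈ A ∧ z ∈ A ∧ w ∈ A) then 1 else 0) g =
      (apPsiC q M C (fun A => if z ∈ A then 1 else 0) (fun A => splitInd x y A * g A) +
          apPsiC q M C (fun A => if w ∈ A then 1 else 0) (fun A => splitInd x y A * g A) +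
          apPsiC q M C (fun A => if x ∈ A then 1 else 0) (fun A => splitInd z w A * g A) +
          apPsiC q M C (fun A => if y ∈ A then 1 else 0) (fun A => splitInd z w A * g A)) / 2 +
        apPsiC q M C (fun A => if x ∈ A ∧ y ∈ A ∧ z ∈ A ∧ w ∈ A then 1 else 0) g := by
  unfold apPsiC
  rw [← Finset.sum_add_distrib, ← Finset.sum_add_distrib, ← Finset.sum_add_distrib, Finset.sum_div, ← Finset.sum_add_distrib]
  refine Finset.sum_congr rfl fun γ _ => ?_
  have hxc : x ∈ M \ γ ↔ x ∉ γ := by rw [Finset.mem_sdiff]; exact ⟨fun h => h.2, fun h => ⟨hx, h⟩⟩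
  have hyc : y ∈ M \ γ ↔ y ∉ γ := by rw [Finset.mem_sdiff]; exact ⟨fun h => h.2, fun h => ⟨hy, h⟩⟩
  have hzc : z ∈ M \ γ ↔ z ∉ γ := by rw [Finset.mem_sdiff]; exact ⟨fun h => h.2, fun h => ⟨hz, h⟩⟩
  have hwc : w ∈ M \ γ ↔ w ∉ γ := by rw [Finset.mem_sdiff]; exact ⟨fun h => h.2, fun h => ⟨hw, h⟩⟩
  dsimp only
  unfold splitInd
  simp only [Finset.mem_union, hxc, hyc, hzc, hwc, hxC, hyC, hzC, hwC, or_false]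
  by_cases a : x ∈ γ <;> by_cases b : y ∈ γ <;> by_cases c : z ∈ γ <;> by_cases d : w ∈ γ <;>
  simp only [a, b, c, d, and_self, and_true, and_false, or_self, or_true, or_false,
    if_true, if_false, not_true_eq_false, not_false_eq_true, iff_true, iff_false] <;> ring

/-- **`≥ 2 of 4` and `≥ 3 of 4` have the same odd part**, with a contracted set. [folklore] -/
theorem apPsiC_thr2of4_eq_thr3of4 (q : ℝ) {M C : Finset (Sym2 V)} {x y z w : Sym2 V} (hx : x ∈ M) (hy : y ∈ M) (hz : z ∈ M)
    (hw : w ∈ M) (hxC : x ∉ C) (hyC : y ∉ C) (hzC : z ∉ C) (hwC : w ∉ C) (g : Finset (Sym2 V) → ℝ) :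
    apPsiC q M C (fun A => if (x ∈ A ∧ y ∈ A) ∨ (x ∈ A ∧ z ∈ A) ∨ (x ∈ A ∧ w ∈ A) ∨ (y ∈ A ∧ z ∈ A) ∨ (y ∈ A ∧ w ∈ A) ∨
        (z ∈ A ∧ w ∈ A) then 1 else 0) g =
      apPsiC q M C (fun A => if (x ∈ A ∧ y ∈ A ∧ z ∈ A) ∨ (x ∈ A ∧ y ∈ A ∧ w ∈ A) ∨ (x ∈ A ∧ z ∈ A ∧ w ∈ A) ∨
        (y ∈ A ∧ z ∈ A ∧ w ∈ A) then 1 else 0) g := by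
  unfold apPsiC
  refine Finset.sum_congr rfl fun γ _ => ?_
  have hxc : x ∈ M \ γ ↔ x ∉ γ := by rw [Finset.mem_sdiff]; exact ⟨fun h => h.2, fun h => ⟨hx, h⟩⟩
  have hyc : y ∈ M \ γ ↔ y ∉ γ := by rw [Finset.mem_sdiff]; exact ⟨fun h => h.2, fun h => ⟨hy, h⟩⟩
  have hzc : z ∈ M \ γ ↔ z ∉ γ := by rw [Finset.mem_sdiff]; exact ⟨fun h => h.2, fun h => ⟨hz, h⟩⟩
  have hwc : w ∈ M \ γ ↔ w ∉ γ := by rw [Finset.mem_sdiff]; exact ⟨fun h => h.2, fun h => ⟨hw, h⟩⟩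
  dsimp only
  simp only [Finset.mem_union, hxc, hyc, hzc, hwc, hxC, hyC, hzC, hwC, or_false]
  by_cases a : x ∈ γ <;> by_cases b : y ∈ γ <;> by_cases c : z ∈ γ <;> by_cases d : w ∈ γ <;>
  simp only [a, b, c, d, and_self, and_true, and_false, or_self, or_true, or_false,
    if_true, if_false, not_true_eq_false, not_false_eq_true] <;> ring

variable [Fintype V] {s t : V}

/-- **The threshold `≥ 3 of 4` in every cell** (`0 < q ≤ 1`). [cite: Grimmett2006, §3.8 Thm. (3.90) (pp. 61–62); §3.9 (pp. 63–64)] -/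
theorem apPsiC_thr3of4_sub_nonpos_of_isTTSP {q : ℝ} (hq0 : 0 < q) (hq1 : q ≤ 1) {E : Finset (Sym2 V)} (hE : IsTTSP E s t)
    (hst : s(s, t) ∉ E) {M C : Finset (Sym2 V)} (hM : M ⊆ insert s(s, t) E) (hC : C ⊆ insert s(s, t) E) (hMC : Disjoint M C)
    {x y z w : Sym2 V} (hx : x ∈ M) (hy : y ∈ M) (hz : z ∈ M) (hw : w ∈ M) (hxy : x ≠ y) (hxz : x ≠ z) (hxw : x ≠ w)
    (hyz : y ≠ z) (hyw : y ≠ w) (hzw : z ≠ w) {g : Finset (Sym2 V) → ℝ}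
    (hgx : ∀ A : Finset (Sym2 V), g (insert x A) = g A) (hgy : ∀ A : Finset (Sym2 V), g (insert y A) = g A)
    (hgz : ∀ A : Finset (Sym2 V), g (insert z A) = g A) (hgw : ∀ A : Finset (Sym2 V), g (insert w A) = g A)
    (hgC : ∀ e ∈ C, ∀ A : Finset (Sym2 V), g (insert e A) = g A)
    (hmono : ∀ ⦃A B : Finset (Sym2 V)⦄, A ⊆ B → B ⊆ M → g A ≤ g B) :
    apPsiC q M C (fun A => if (x ∈ A ∧ y ∈ A ∧ z ∈ A) ∨ (x ∈ A ∧ y ∈ A ∧ w ∈ A) ∨ (x ∈ A ∧ z ∈ A ∧ w ∈ A) ∨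
        (y ∈ A ∧ z ∈ A ∧ w ∈ A) then 1 else 0) g ≤ 0 := by
  have hxC : x ∉ C := fun h => Finset.disjoint_left.1 hMC hx h
  have hyC : y ∉ C := fun h => Finset.disjoint_left.1 hMC hy h
  have hzC : z ∉ C := fun h => Finset.disjoint_left.1 hMC hz h
  have hwC : w ∉ C := fun h => Finset.disjoint_left.1 hMC hw h
  rw [apPsiC_thr3of4_eq q hx hy hz hw hxC hyC hzC hwC]
  have h1 := apPsiC_pivot_split_sub_nonpos_of_isTTSP hq0 hq1 hE hst hM hC hMC hz hx hy hxz.symm hyz.symm hxy hgz hgx hgy hgC hmono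
  have h2 := apPsiC_pivot_split_sub_nonpos_of_isTTSP hq0 hq1 hE hst hM hC hMC hw hx hy hxw.symm hyw.symm hxy hgw hgx hgy hgC hmono
  have h3 := apPsiC_pivot_split_sub_nonpos_of_isTTSP hq0 hq1 hE hst hM hC hMC hx hz hw hxz hxw hzw hgx hgz hgw hgC hmono
  have h4 := apPsiC_pivot_split_sub_nonpos_of_isTTSP hq0 hq1 hE hst hM hC hMC hy hz hw hyz hyw hzw hgy hgz hgw hgC hmono
  have hS : ({x, y, z, w} : Finset (Sym2 V)) ⊆ M := by
    intro e he
    simp only [Finset.mem_insert, Finset.mem_singleton] at he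
    rcases he with rfl | rfl | rfl | rfl <;> assumption
  have h5 := apPsiC_andSet_sub_nonpos_of_isTTSP hq0 hq1 hE hst hM hC hMC hS ⟨x, by simp⟩ (fun e he A => by
    simp only [Finset.mem_insert, Finset.mem_singleton] at he
    rcases he with rfl | rfl | rfl | rfl
    · exact hgx A
    · exact hgy A
    · exact hgz A
    · exact hgw A) hgC hmono
  have hfun : (fun X : Finset (Sym2 V) => if ({x, y, z, w} : Finset (Sym2 V)) ⊆ X then (1 : ℝ) else 0) =
      fun A => if x ∈ A ∧ y ∈ A ∧ z ∈ A ∧ w ∈ A then (1 : ℝ) else 0 := by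
    funext X; simp only [Finset.insert_subset_iff, Finset.singleton_subset_iff]
  rw [hfun] at h5
  linarith

/-- **The threshold `≥ 2 of 4` in every cell** (`0 < q ≤ 1`). [cite: Grimmett2006, §3.8 Thm. (3.90) (pp. 61–62); §3.9 (pp. 63–64)] -/
theorem apPsiC_thr2of4_sub_nonpos_of_isTTSP {q : ℝ} (hq0 : 0 < q) (hq1 : q ≤ 1) {E : Finset (Sym2 V)} (hE : IsTTSP E s t)
    (hst : s(s, t) ∉ E) {M C : Finset (Sym2 V)} (hM : M ⊆ insert s(s, t) E) (hC : C ⊆ insert s(s, t) E) (hMC : Disjoint M C)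
    {x y z w : Sym2 V} (hx : x ∈ M) (hy : y ∈ M) (hz : z ∈ M) (hw : w ∈ M) (hxy : x ≠ y) (hxz : x ≠ z) (hxw : x ≠ w)
    (hyz : y ≠ z) (hyw : y ≠ w) (hzw : z ≠ w) {g : Finset (Sym2 V) → ℝ}
    (hgx : ∀ A : Finset (Sym2 V), g (insert x A) = g A) (hgy : ∀ A : Finset (Sym2 V), g (insert y A) = g A)
    (hgz : ∀ A : Finset (Sym2 V), g (insert z A) = g A) (hgw : ∀ A : Finset (Sym2 V), g (insert w A) = g A)
    (hgC : ∀ e ∈ C, ∀ A : Finset (Sym2 V), g (insert e A) = g A)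
    (hmono : ∀ ⦃A B : Finset (Sym2 V)⦄, A ⊆ B → B ⊆ M → g A ≤ g B) :
    apPsiC q M C (fun A => if (x ∈ A ∧ y ∈ A) ∨ (x ∈ A ∧ z ∈ A) ∨ (x ∈ A ∧ w ∈ A) ∨ (y ∈ A ∧ z ∈ A) ∨
        (y ∈ A ∧ w ∈ A) ∨ (z ∈ A ∧ w ∈ A) then 1 else 0) g ≤ 0 := by
  have hxC : x ∉ C := fun h => Finset.disjoint_left.1 hMC hx h
  have hyC : y ∉ C := fun h => Finset.disjoint_left.1 hMC hy h
  have hzC : z ∉ C := fun h => Finset.disjoint_left.1 hMC hz h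
  have hwC : w ∉ C := fun h => Finset.disjoint_left.1 hMC hw h
  rw [apPsiC_thr2of4_eq_thr3of4 q hx hy hz hw hxC hyC hzC hwC]
  exact apPsiC_thr3of4_sub_nonpos_of_isTTSP hq0 hq1 hE hst hM hC hMC hx hy hz hw hxy hxz hxw hyz hyw hzw hgx hgy hgz hgw hgC hmono

end FK

end Summit.CriticalPhenomena.PercolationContinuityZ3.Theorems

end
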